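import Summits.PneNP.PneNP.Theorems.CodingVolumeShiftsCodingVolumeEntropyLevel

/-!
# Route CodingVolumeShifts — crux `CodingVolume` (stmt-PneNP-19454): the cell `C = 4` for GENERAL
# binary one-shot codes

Final part of the `C = 4` rung of the ladder X = `CodingVolume` for ARBITRARY binary one-shot codes
(no linearity, no degree bound): a k-pairs network all of whose source–sink pairs are at undirected
distance `≥ 4` and which carries a binary one-shot code has at least `4k` arcs — the routing volume,
with the optimal `L = 4` (`CodingVolume.Negative.codingVolume_ceiling`). This closes the cell
`C = 4` of the crux for every `Δ` (the linear case is `codingVolume_four_mul_card_le_arcCount_of_linear`).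

The argument is the entropy translation of the linear proof: inputs `x` uniform on the cube, the
POTENTIAL `Φ_R = Σ_{v middle} H(In v | x|_{level < R})` filtered by the levels of the commodities
(level = least rank of a middle vertex receiving an effective arc from the source), the per-level
inequality `codingVolume_entropy_level` (credits: effective source arcs, DEPARTURE by the hybrid
argument of `codingVolume_departure`, sink in-arcs and pure-sink feeders), and telescoping from
`Φ_0 ≤ Σ_{v middle} |In v|` to `Φ_top = 0`.

* `codingVolume_entropy_potential` — `4k ≤ Σ_{v middle} H(In v) + Σ_i |In(sink i)|`;
* `codingVolume_four_mul_card_le_arcCount` — `N.Far 4 → N.Code → 4·k ≤ m`;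
* `codingVolume_rung_four` — the cell in the shape of the crux:
  `∀ Δ, ∃ L (= 4), ∀ ι N, N.DegLE Δ → N.Far L → Nonempty N.Code → 4·k ≤ m`.

No definitions. [folklore]
-/

set_option linter.dupNamespace false -- `Summit.PneNP.PneNP.…`: summit = sub-problem name (D-0017)

namespace Summit.PneNP.PneNP.Theorems

open Literature.InformationTheory.NetworkCoding Literature.InformationTheory.Entropy Finset

section Four

variable {ι : Type} [Fintype ι] [DecidableEq ι] {N : KPairsNet ι}

/-- **THE ENTROPY POTENTIAL BOUND.** For a `4`-far k-pairs network carrying a binary one-shot code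
`c`: `4k ≤ Σ_{v middle} H(In v) + Σ_i |In(sink i)|`, where `H(In v)` is the entropy of the tuple of
bits entering `v` on a uniform input (telescoping the per-level inequalities
`codingVolume_entropy_level` along the filtration by levels). [folklore] -/
theorem codingVolume_entropy_potential (c : N.Code) (hfar : N.Far 4) :
    4 * (Fintype.card ι : ℝ) ≤
      (∑ v ∈ univ.filter (fun v : N.V => (∀ j, v ≠ N.source j) ∧ ∀ j, v ≠ N.sink j),
        mapEntropy (univ : Finset (ι → Bool)) (fun x => fun b => if b ∈ N.inArcs v then
          c.val b x else false)) + ∑ i, ((N.inArcs (N.sink i)).card : ℝ) := by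
  classical
  set Mset := univ.filter (fun v : N.V => (∀ j, v ≠ N.source j) ∧ ∀ j, v ≠ N.sink j) with hM
  let In : N.V → (ι → Bool) → (N.A → Bool) := fun v x b =>
    if b ∈ N.inArcs v then c.val b x else false
  -- the levels
  have hfar2 : ∀ i, (2 : ℕ∞) ≤ N.graph.edist (N.source i) (N.sink i) := fun i =>
    le_trans (by exact_mod_cast (by norm_num : (2 : ℕ) ≤ 4)) (hfar i)
  let Rk : ι → Finset ℕ := fun i => (univ.filter (fun a => N.src a = N.source i ∧
    (∀ l, N.tgt a ≠ N.sink l) ∧ ∃ y y' : ι → Bool, c.val a y ≠ c.val a y')).image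
    (fun a => N.rank (N.tgt a))
  have hRk : ∀ i, (Rk i).Nonempty := by
    intro i
    obtain ⟨a, ha, haM, hz⟩ := codingVolume_exists_effective_middle_arc c i (hfar2 i)
    exact ⟨_, Finset.mem_image_of_mem _ (by rw [Finset.mem_filter]; exact
      ⟨Finset.mem_univ _, ha, haM, hz⟩)⟩
  let hr : ι → ℕ := fun i => (Rk i).min' (hRk i)
  have hrA : ∀ i, ∃ a, N.src a = N.source i ∧ (∀ l, N.tgt a ≠ N.sink l) ∧
      (∃ y y' : ι → Bool, c.val a y ≠ c.val a y') ∧ N.rank (N.tgt a) = hr i := by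
    intro i
    have hmem := Finset.min'_mem (Rk i) (hRk i)
    obtain ⟨a, ha, hrk⟩ := Finset.mem_image.mp hmem
    rw [Finset.mem_filter] at ha
    exact ⟨a, ha.2.1, ha.2.2.1, ha.2.2.2, hrk⟩
  have hhr : ∀ i a, N.src a = N.source i → (∀ l, N.tgt a ≠ N.sink l) →
      (∃ y y' : ι → Bool, c.val a y ≠ c.val a y') → hr i ≤ N.rank (N.tgt a) := by
    intro i a ha haM hz
    refine Finset.min'_le (Rk i) _ (Finset.mem_image_of_mem _ ?_)
    rw [Finset.mem_filter]; exact ⟨Finset.mem_univ _, ha, haM, hz⟩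
  -- telescoping along `R`
  have step : ∀ R : ℕ,
      (∑ v ∈ Mset, (mapEntropy univ (fun x => (In v x, (fun j => if j ∈ univ.filter
          (fun j => hr j < R) then x j else false))) - mapEntropy univ (fun x : ι → Bool =>
          fun j => if j ∈ univ.filter (fun j => hr j < R) then x j else false))) +
        4 * ((univ.filter fun i => hr i < R).card : ℝ) ≤
      (∑ v ∈ Mset, mapEntropy univ (In v)) +
        ∑ i ∈ univ.filter (fun i => hr i < R), ((N.inArcs (N.sink i)).card : ℝ) := by
    intro R
    induction R with
    | zero =>
      have h0 : (univ.filter fun i => hr i < 0) = ∅ := by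
        rw [Finset.filter_eq_empty_iff]; intro i _; exact Nat.not_lt_zero _
      rw [h0]
      simp only [Finset.card_empty, Nat.cast_zero, mul_zero, add_zero, Finset.sum_empty,
        Finset.notMem_empty, if_false]
      refine Finset.sum_le_sum fun v _ => ?_
      have h := mapEntropy_prod_le univ (In v) (fun _ : ι → Bool => fun _ : ι => false)
      linarith
    | succ R ih =>
      have hlev := codingVolume_entropy_level c hfar hr hrA hhr R
        (univ.filter fun j => hr j < R) (univ.filter fun j => hr j < R + 1)
        (fun j => by simp) (fun j => by simp)
      rw [← hM] at hlev
      -- split `{hr < R + 1}` into `{hr < R}` and `{hr = R}`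
      have hsplitc : (univ.filter fun i => hr i < R + 1).card =
          (univ.filter fun i => hr i < R).card + (univ.filter fun i => hr i = R).card := by
        rw [← Finset.card_union_of_disjoint]
        · congr 1; ext i; simp only [Finset.mem_filter, Finset.mem_univ, true_and,
            Finset.mem_union]; omega
        · rw [Finset.disjoint_filter]; intro i _ h; omega
      have hsplits : ∑ i ∈ univ.filter (fun i => hr i < R + 1), ((N.inArcs (N.sink i)).card : ℝ) =
          ∑ i ∈ univ.filter (fun i => hr i < R), ((N.inArcs (N.sink i)).card : ℝ) +
          ∑ i ∈ univ.filter (fun i => hr i = R), ((N.inArcs (N.sink i)).card : ℝ) := by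
        rw [← Finset.sum_union]
        · congr 1; ext i; simp only [Finset.mem_filter, Finset.mem_univ, true_and,
            Finset.mem_union]; omega
        · rw [Finset.disjoint_filter]; intro i _ h; omega
      have hsplitc' : ((univ.filter fun i => hr i < R + 1).card : ℝ) =
          ((univ.filter fun i => hr i < R).card : ℝ) + ((univ.filter fun i => hr i = R).card : ℝ) := by
        exact_mod_cast hsplitc
      rw [hsplitc', hsplits]
      linarith
  -- at `R = max + 1` everything is conditioned away
  set R := univ.sup hr + 1 with hR
  have hall : ∀ i, hr i < R := fun i => Nat.lt_succ_of_le (Finset.le_sup (f := hr) (mem_univ i))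
  have hst := step R
  have hz : ∀ v : N.V, mapEntropy univ (fun x => (In v x, (fun j => if j ∈ univ.filter
      (fun j => hr j < R) then x j else false))) - mapEntropy univ (fun x : ι → Bool =>
      fun j => if j ∈ univ.filter (fun j => hr j < R) then x j else false) = 0 := by
    intro v
    refine codingVolume_ent_cond_eq_zero univ (In v) _ fun x _ x' _ h => ?_
    have hx : x = x' := by
      funext j
      have := congrFun h j
      simpa [hall j] using this
    rw [hx]
  simp only [hz, Finset.sum_const_zero, zero_add] at hst
  have hcard : (univ.filter fun i => hr i < R).card = Fintype.card ι := by
    rw [Finset.filter_true_of_mem (fun i _ => hall i), Finset.card_univ]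
  have hsumall : ∑ i ∈ univ.filter (fun i => hr i < R), ((N.inArcs (N.sink i)).card : ℝ) =
      ∑ i, ((N.inArcs (N.sink i)).card : ℝ) := by
    rw [Finset.filter_true_of_mem (fun i _ => hall i)]
  rw [hcard, hsumall] at hst
  exact hst

/-- **Cell `C = 4` of `CodingVolume` for GENERAL binary one-shot codes (arc form).** A k-pairs
network whose source–sink pairs are all at undirected distance `≥ 4` and which carries a binary
one-shot network code has at least `4k` arcs. No degree bound and no linearity is assumed; `L = 4`
is optimal (`CodingVolume.Negative.codingVolume_ceiling`). Proof: the entropy potential bound,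
`H(In v) ≤ |In v|`, and the partition of the arcs by their heads. [folklore] -/
theorem codingVolume_four_mul_card_le_arcCount (N : KPairsNet ι) (hfar : N.Far 4) (c : N.Code) :
    4 * Fintype.card ι ≤ N.arcCount := by
  classical
  have h := codingVolume_entropy_potential c hfar
  set Mset := univ.filter (fun v : N.V => (∀ j, v ≠ N.source j) ∧ ∀ j, v ≠ N.sink j) with hM
  -- `H(In v) ≤ |In v|`
  have hfin : ∀ v : N.V, mapEntropy (univ : Finset (ι → Bool)) (fun x => fun b =>
      if b ∈ N.inArcs v then c.val b x else false) ≤ (N.inArcs v).card := fun v =>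
    codingVolume_mask_le_card' univ (fun x b => c.val b x) (N.inArcs v)
  have h1 : ∑ v ∈ Mset, mapEntropy (univ : Finset (ι → Bool)) (fun x => fun b =>
      if b ∈ N.inArcs v then c.val b x else false) ≤ ∑ v ∈ Mset, ((N.inArcs v).card : ℝ) :=
    Finset.sum_le_sum fun v _ => hfin v
  -- arcs partitioned by head
  have htot : ∑ v, (N.inArcs v).card = N.arcCount := by
    rw [KPairsNet.arcCount, ← Finset.card_univ, Finset.card_eq_sum_card_fiberwise
      (f := N.tgt) (t := Finset.univ) (fun a _ => Finset.mem_univ _)]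
    rfl
  have hsinks : ∑ i, (N.inArcs (N.sink i)).card = ∑ v ∈ univ.image N.sink, (N.inArcs v).card := by
    rw [Finset.sum_image (fun i _ j _ h => N.sink.injective h)]
  have hdisj : Disjoint Mset (univ.image N.sink) := by
    rw [Finset.disjoint_left]
    intro v hv hv'
    rw [hM, Finset.mem_filter] at hv
    obtain ⟨j, -, hj⟩ := Finset.mem_image.mp hv'
    exact hv.2.2 j hj.symm
  have h2 : ∑ v ∈ Mset, (N.inArcs v).card + ∑ v ∈ univ.image N.sink, (N.inArcs v).card ≤
      ∑ v, (N.inArcs v).card := by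
    rw [← Finset.sum_union hdisj]
    exact Finset.sum_le_sum_of_subset_of_nonneg (Finset.subset_univ _) fun _ _ _ => Nat.zero_le _
  have h3 : (∑ v ∈ Mset, ((N.inArcs v).card : ℝ)) + ∑ i, ((N.inArcs (N.sink i)).card : ℝ) ≤
      (N.arcCount : ℝ) := by
    have : ∑ v ∈ Mset, (N.inArcs v).card + ∑ i, (N.inArcs (N.sink i)).card ≤ N.arcCount := by
      rw [hsinks, ← htot]; exact h2
    exact_mod_cast this
  have h4 : 4 * (Fintype.card ι : ℝ) ≤ (N.arcCount : ℝ) := by linarith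
  exact_mod_cast h4

/-- **Rung of `CodingVolume` (crux stmt-PneNP-19454): the cell `C = 4`, every `Δ`, GENERAL codes,
in the shape of the crux** — `∀ Δ, ∃ L (= 4), ∀ N, N.DegLE Δ → N.Far L → Nonempty N.Code →
4·k ≤ m`. The crux asks this for every `C` (with `L` depending on `Δ` and `C`); here the degree
bound is not even used. [folklore] -/
theorem codingVolume_rung_four : ∀ Δ : ℕ, ∃ L : ℕ, ∀ (ι : Type) [Fintype ι] (N : KPairsNet ι),
    N.DegLE Δ → N.Far L → Nonempty N.Code → 4 * Fintype.card ι ≤ N.arcCount := by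
  intro _
  refine ⟨4, fun ι _ N _ hfar ⟨c⟩ => ?_⟩
  classical
  exact codingVolume_four_mul_card_le_arcCount N hfar c

/-- **State of the ladder: every cell `(Δ, C)` with `C ≤ 4`.** For all `Δ` and all `C ≤ 4` the
distance `L := 4` (indeed `L := max C 1` would do, by the rungs `C = 2, 3`) forces `C·k ≤ m` on
every `Δ`-bounded `L`-far k-pairs network carrying a binary one-shot code — the crux
`CodingVolume` restricted to `C ≤ 4`, with the degree bound unused. [folklore] -/
theorem codingVolume_cells_le_four : ∀ Δ C : ℕ, C ≤ 4 → ∃ L : ℕ, ∀ (ι : Type) [Fintype ι]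
    (N : KPairsNet ι), N.DegLE Δ → N.Far L → Nonempty N.Code → C * Fintype.card ι ≤ N.arcCount := by
  intro Δ C hC
  obtain ⟨L, hL⟩ := codingVolume_rung_four Δ
  refine ⟨L, fun ι _ N hΔ hfar hc => ?_⟩
  exact (Nat.mul_le_mul_right _ hC).trans (hL ι N hΔ hfar hc)

end Four

end Summit.PneNP.PneNP.Theorems
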